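import Literature.NumberTheory.ComplexMultiplication.ReflexTypeNormDescent
import HarnessLib

/-!
# The reflex type norm does not depend on the base embedding, and lies under `𝔞^{σ₀}` along every `φ ∈ Φ`:
# `φ(g(𝔞))𝔬_L ⊆ 𝔞^{σ₀}𝔬_L` (Shimura 1998, §8.3 Prop. 29 and §13.1 (1), (7); §13.2, pp. 99–100)

Topic `Literature/NumberTheory/ComplexMultiplication`, namespace `Literature.NumberTheory.ComplexMultiplication`.
Cell `hodgecm-mathlib` (D-0151), fan B-II, E2 background programme (A-p02, `ROAD-E2-heightOne-S2degOne.md` §1 S3 /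
§2 P1): the «reflex inclusion» brick.  Theorems only; no definition, no named fact, no `sorry`.

## Setting (= that of the predicate `IsReflexTypeNorm`, `ShimuraTaniyamaHecke.lean`)

Number fields `K`, `k`, `L` (typically `L/ℚ` normal), a subset `Φ ⊆ Hom(K, L)` (a CM type of `K` read in `L`,
`Φ = valuedIn ι Φ_ℂ`), embeddings `j : K → L` (base point) and `σ₀ : k → L`, an ideal `𝔞 ⊆ 𝔬_k`; the reflex type ON `k`
seen from `j` is `Ψ_j = reflexTypeOn Φ j σ₀ = {g ∘ σ₀ | g ∈ Aut(L), g⁻¹ ∘ j ∈ Φ}`, the reflex type norm read in `𝔬_L` is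
`reflexNormIdeal Φ j σ₀ 𝔞 = ∏_{σ ∈ Ψ_j} 𝔞^σ𝔬_L`, and `IsReflexTypeNorm Φ j σ₀ 𝔞 𝔟` says `j(𝔟)𝔬_L = ∏_{σ ∈ Ψ_j} 𝔞^σ𝔬_L`
(Shimura: `𝔬_L g(𝔞) = 𝔬_L ∏_α 𝔞^{ψ_α}`, §13.1 (1); `∏_{τ ∈ S*} 𝔓₁^τ ∼ ∏_α N_{k₁/K*}(𝔓₁)^{ψ_α}`, (7)).
`Aut(L) = L ≃+* L` acts on embeddings by composition (scoped `ringEquivCompAction`, `g • σ = g ∘ σ`).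

## What is here (all proved)

* §1 CHANGE OF BASE EMBEDDING («we extend the `ψ_α` to isomorphisms of `k` onto subfields of `ℚ̄`»; the descended ideal
  `𝔟 = g(𝔞)` lives in `K` and does not remember through which embedding `K → L` it was computed):
  `map_mapRingHom_smul` (`𝔞^{g ∘ σ}𝔬_L = (𝔞^σ𝔬_L)^g`), **`reflexNormIdeal_smul_left`**
  (`∏_{σ ∈ Ψ_{g ∘ j}} 𝔞^σ = (∏_{σ ∈ Ψ_j} 𝔞^σ)^g`, from `Ψ_{g ∘ j} = g ∘ Ψ_j` = `reflexTypeOn_smul_left`),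
  **`IsReflexTypeNorm.smul_left`** / `isReflexTypeNorm_smul_left_iff` and, for `L/ℚ` normal (any two embeddings
  `K → L` are conjugate, `exists_ringEquiv_smul_eq`), **`IsReflexTypeNorm.of_basePoint`**:
  `IsReflexTypeNorm Φ j σ₀ 𝔞 𝔟 → IsReflexTypeNorm Φ j' σ₀ 𝔞 𝔟` for every `j'`.
* §2 THE REFLEX INCLUSION (Shimura §13.2, pp. 99–100: for `φ ∈ Φ` the prime `𝔓̃` of the big field divides `φ(g(𝔭))` —
  the step «`φ(α) ∈ 𝔓̃` for all `α ∈ 𝔮 = g(𝔭)` and all `φ ∈ Φ`» of the degree-one argument pp. 127–128 (proof of Thm. 18.6) / A-p02's road S3):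
  `self_mem_reflexTypeOn` (`σ₀ ∈ Ψ_φ` for `φ ∈ Φ`), `reflexNormIdeal_le_map_of_mem` (the product is contained in each
  factor: `∏_{σ ∈ Ψ_j} 𝔞^σ𝔬_L ⊆ 𝔞^σ𝔬_L`), **`IsReflexTypeNorm.map_le_map`**
  (`[Normal ℚ L] → φ ∈ Φ → φ(𝔟)𝔬_L ⊆ 𝔞^{σ₀}𝔬_L`), its element/prime forms `IsReflexTypeNorm.mapRingHom_mem`
  (`𝔞^{σ₀}𝔬_L ⊆ 𝔓 → α ∈ 𝔟 → φ(α) ∈ 𝔓`) and `IsReflexTypeNorm.mapRingHom_mem_of_le_comap`, and the CM-type spelling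
  over `valuedIn ι Φ_ℂ` used by `shimuraTaniyamaPair_degOne'` (`IsReflexTypeNorm.map_le_map_of_comp_mem`,
  `IsReflexTypeNorm.mapRingHom_mem_of_comp_mem`).

## References

* [Shimura1998] G. Shimura, *Abelian Varieties with Complex Multiplication and Modular Functions*, Princeton 1998:
  §8.3 Prop. 29 (p. 63); §13.1 (1), (7) (pp. 96–97); §13.2 (pp. 99–100, the primes `𝔓₁^τ`, `τ ∈ S*`, dividing `g(𝔭)`);
  §18.6, proof of Thm. 18.6, reduction modulo 𝔓 passage (pp. 127–128).
* [SerreTate1968] J.-P. Serre, J. Tate, *Good reduction of abelian varieties*, Ann. of Math. 88 (1968), §7.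
-/

noncomputable section

open scoped NumberField Pointwise
open NumberField

namespace Literature.NumberTheory.ComplexMultiplication

/-! ## §1. Change of base embedding -/

section BasePoint

variable {K k L : Type*} [Field K] [Field k] [Field L]

/-- Restricting a composite of field embeddings to rings of integers is the composite of the restrictions.
[folklore] -/
private theorem mapRingHom_comp_mapRingHom (f : k →+* K) (g : K →+* L) :
    (RingOfIntegers.mapRingHom g).comp (RingOfIntegers.mapRingHom f) = RingOfIntegers.mapRingHom (g.comp f) :=
  RingHom.ext fun _ => RingOfIntegers.ext rfl

/-- `𝔞^{g ∘ σ}𝔬_L = (𝔞^σ𝔬_L)^g`: extending an ideal along `g ∘ σ` is extending along `σ` and then applying the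
automorphism `g` of `L` (Shimura's exponential notation `𝔞^{ψσ} = (𝔞^ψ)^σ` for conjugate ideals, §8.3, proof of
Prop. 29: «`β^σ = ∏ α^{ψⱼσ}`»). [cite: Shimura1998, §8.3 Prop. 29 (proof), p. 63; §13.1 (7)] -/
theorem map_mapRingHom_smul (g : L ≃+* L) (σ : k →+* L) (𝔞 : Ideal (𝓞 k)) :
    𝔞.map (RingOfIntegers.mapRingHom (g • σ)) =
      (𝔞.map (RingOfIntegers.mapRingHom σ)).map (RingOfIntegers.mapRingHom g.toRingHom) := by
  rw [ringEquiv_smul_def, ← mapRingHom_comp_mapRingHom, Ideal.map_map]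

variable [NumberField k] [NumberField L]

/-- **`∏_{σ ∈ Ψ_{g ∘ j}} 𝔞^σ𝔬_L = (∏_{σ ∈ Ψ_j} 𝔞^σ𝔬_L)^g`**: replacing the base embedding `j` of `K` by `g ∘ j`
replaces the reflex type `Ψ_j` by `g ∘ Ψ_j` (`reflexTypeOn_smul_left`, Shimura's «replacing `ε` by `hε` replaces `S*`
by `hS*`»), hence the reflex type norm ideal by its image under `g`. [cite: Shimura1998, §13.1 (1), (7); Prop. 19.10 (19.10c)] -/
theorem reflexNormIdeal_smul_left (Φ : Set (K →+* L)) (j : K →+* L) (σ₀ : k →+* L) (𝔞 : Ideal (𝓞 k))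
    (g : L ≃+* L) :
    reflexNormIdeal Φ (g • j) σ₀ 𝔞 =
      (reflexNormIdeal Φ j σ₀ 𝔞).map (RingOfIntegers.mapRingHom g.toRingHom) := by
  classical
  rw [reflexNormIdeal_eq_prod, reflexNormIdeal_eq_prod, ← Ideal.mapHom_apply, map_prod]
  simp only [Ideal.mapHom_apply]
  symm
  refine Finset.prod_equiv (MulAction.toPerm g) (fun σ => ?_) (fun σ _ => ?_)
  · rw [Set.Finite.mem_toFinset, Set.Finite.mem_toFinset, MulAction.toPerm_apply, reflexTypeOn_smul_left,
      Set.smul_mem_smul_set_iff]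
  · rw [MulAction.toPerm_apply, map_mapRingHom_smul]

/-- **The descended ideal does not depend on the base embedding (same `Aut(L)`-orbit)**: if
`j(𝔟)𝔬_L = ∏_{σ ∈ Ψ_j} 𝔞^σ𝔬_L` then `(g ∘ j)(𝔟)𝔬_L = ∏_{σ ∈ Ψ_{g ∘ j}} 𝔞^σ𝔬_L` (apply `g` to both sides).
[cite: Shimura1998, §8.3 Prop. 29, p. 63; §13.1 (1)] -/
theorem IsReflexTypeNorm.smul_left {Φ : Set (K →+* L)} {j : K →+* L} {σ₀ : k →+* L} {𝔞 : Ideal (𝓞 k)}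
    {𝔟 : Ideal (𝓞 K)} (h : IsReflexTypeNorm Φ j σ₀ 𝔞 𝔟) (g : L ≃+* L) :
    IsReflexTypeNorm Φ (g • j) σ₀ 𝔞 𝔟 := by
  rw [IsReflexTypeNorm, map_mapRingHom_smul, reflexNormIdeal_smul_left]
  exact congrArg _ h

/-- `IsReflexTypeNorm Φ (g ∘ j) σ₀ 𝔞 𝔟 ↔ IsReflexTypeNorm Φ j σ₀ 𝔞 𝔟`. [cite: Shimura1998, §8.3 Prop. 29, p. 63; §13.1 (1)] -/
theorem isReflexTypeNorm_smul_left_iff {Φ : Set (K →+* L)} {j : K →+* L} {σ₀ : k →+* L} {𝔞 : Ideal (𝓞 k)}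
    {𝔟 : Ideal (𝓞 K)} (g : L ≃+* L) :
    IsReflexTypeNorm Φ (g • j) σ₀ 𝔞 𝔟 ↔ IsReflexTypeNorm Φ j σ₀ 𝔞 𝔟 :=
  ⟨fun h => by simpa only [inv_smul_smul] using h.smul_left g⁻¹, fun h => h.smul_left g⟩

/-- **Independence of the base embedding, `L/ℚ` normal**: any two embeddings `j, j' : K → L` are conjugate under
`Aut(L)` (`exists_ringEquiv_smul_eq`), so `𝔟` is the reflex type norm of `𝔞` seen from `j` iff it is so seen from
`j'` («we extend the `ψ_α` to isomorphisms of `k` onto subfields of `ℚ̄`, which we denote again by `ψ_α`» — the choice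
does not matter). [cite: Shimura1998, §13.1, p. 96 (before (1)); §8.3 Prop. 29, p. 63] -/
theorem IsReflexTypeNorm.of_basePoint [CharZero K] [Normal ℚ L] {Φ : Set (K →+* L)} {j : K →+* L} {σ₀ : k →+* L}
    {𝔞 : Ideal (𝓞 k)} {𝔟 : Ideal (𝓞 K)} (h : IsReflexTypeNorm Φ j σ₀ 𝔞 𝔟) (j' : K →+* L) :
    IsReflexTypeNorm Φ j' σ₀ 𝔞 𝔟 := by
  obtain ⟨g, hg⟩ := exists_ringEquiv_smul_eq j j'
  rw [← hg]
  exact h.smul_left g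

/-- `L/ℚ` normal: the predicates for two base embeddings are equivalent. [cite: Shimura1998, §13.1, p. 96; §8.3 Prop. 29] -/
theorem isReflexTypeNorm_iff_of_basePoint [CharZero K] [Normal ℚ L] {Φ : Set (K →+* L)} (j j' : K →+* L)
    {σ₀ : k →+* L} {𝔞 : Ideal (𝓞 k)} {𝔟 : Ideal (𝓞 K)} :
    IsReflexTypeNorm Φ j σ₀ 𝔞 𝔟 ↔ IsReflexTypeNorm Φ j' σ₀ 𝔞 𝔟 :=
  ⟨fun h => h.of_basePoint j', fun h => h.of_basePoint j⟩

end BasePoint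

/-! ## §2. The reflex inclusion `φ(g(𝔞))𝔬_L ⊆ 𝔞^{σ₀}𝔬_L` for `φ ∈ Φ` -/

section Inclusion

variable {K k L : Type*} [Field K] [Field k] [Field L]

/-- `σ₀ ∈ Ψ_φ` whenever `φ ∈ Φ` (take `g = 1` in `Ψ_φ = {g ∘ σ₀ | g⁻¹ ∘ φ ∈ Φ}`): seen from a base point IN the type,
the base embedding of `k` itself belongs to the reflex type on `k`. [cite: Shimura1998, §13.1 (7)] -/
theorem self_mem_reflexTypeOn {Φ : Set (K →+* L)} {φ : K →+* L} (σ₀ : k →+* L) (hφ : φ ∈ Φ) :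
    σ₀ ∈ reflexTypeOn Φ φ σ₀ := by
  have h := smul_mem_reflexTypeOn (Φ := Φ) (τ := φ) σ₀ (g := 1) (by rwa [inv_one, one_smul])
  rwa [one_smul] at h

variable [NumberField k] [NumberField L]

/-- **The product is contained in each factor**: `∏_{σ ∈ Ψ_j} 𝔞^σ𝔬_L ⊆ 𝔞^σ𝔬_L` for every `σ ∈ Ψ_j`.
[cite: Shimura1998, §13.1 (1), (7)] -/
theorem reflexNormIdeal_le_map_of_mem (Φ : Set (K →+* L)) (j : K →+* L) (σ₀ : k →+* L) (𝔞 : Ideal (𝓞 k))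
    {σ : k →+* L} (hσ : σ ∈ reflexTypeOn Φ j σ₀) :
    reflexNormIdeal Φ j σ₀ 𝔞 ≤ 𝔞.map (RingOfIntegers.mapRingHom σ) := by
  classical
  rw [reflexNormIdeal_eq_prod,
    ← Finset.mul_prod_erase _ _ ((finite_reflexTypeOn Φ j σ₀).mem_toFinset.2 hσ)]
  exact Ideal.mul_le_right

/-- Divisibility form: `𝔞^σ𝔬_L ∣ ∏_{σ ∈ Ψ_j} 𝔞^σ𝔬_L` for `σ ∈ Ψ_j`. [cite: Shimura1998, §13.1 (1), (7)] -/
theorem map_dvd_reflexNormIdeal_of_mem (Φ : Set (K →+* L)) (j : K →+* L) (σ₀ : k →+* L) (𝔞 : Ideal (𝓞 k))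
    {σ : k →+* L} (hσ : σ ∈ reflexTypeOn Φ j σ₀) :
    𝔞.map (RingOfIntegers.mapRingHom σ) ∣ reflexNormIdeal Φ j σ₀ 𝔞 := by
  classical
  rw [reflexNormIdeal_eq_prod]
  exact Finset.dvd_prod_of_mem _ ((finite_reflexTypeOn Φ j σ₀).mem_toFinset.2 hσ)

/-- Seen from a base point `φ ∈ Φ`, the reflex type norm ideal lies in `𝔞^{σ₀}𝔬_L` (the factor `σ = σ₀ ∈ Ψ_φ`).
[cite: Shimura1998, §13.1 (1), (7); §13.2, pp. 99–100] -/
theorem reflexNormIdeal_le_map_self {Φ : Set (K →+* L)} {φ : K →+* L} (σ₀ : k →+* L) (𝔞 : Ideal (𝓞 k))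
    (hφ : φ ∈ Φ) : reflexNormIdeal Φ φ σ₀ 𝔞 ≤ 𝔞.map (RingOfIntegers.mapRingHom σ₀) :=
  reflexNormIdeal_le_map_of_mem Φ φ σ₀ 𝔞 (self_mem_reflexTypeOn σ₀ hφ)

variable [CharZero K] [Normal ℚ L]

/-- **The reflex inclusion** (Shimura §13.2, pp. 99–100: the primes `𝔓₁^τ`, `τ ∈ S*`, divide `𝔬_L g(𝔭)`; read along
`φ ∈ Φ`): if `j(𝔟)𝔬_L = ∏_{σ ∈ Ψ_j} 𝔞^σ𝔬_L` (`𝔟 = g(𝔞)`) and `L/ℚ` is normal then `φ(𝔟)𝔬_L ⊆ 𝔞^{σ₀}𝔬_L` for EVERY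
`φ ∈ Φ` — change the base point to `φ` (`IsReflexTypeNorm.of_basePoint`) and take the factor `σ₀ ∈ Ψ_φ`.  This is the
input «`φ(α) ∈ 𝔓̃` for all `α ∈ 𝔮 = g(𝔭)`, `φ ∈ Φ`» of the degree-one argument on pp. 127–128, proof of Thm. 18.6 (every `Φ`-eigenvalue of
`ι̃(α)` on the tangent space of the reduction vanishes).
[cite: Shimura1998, §13.2, pp. 99–100; §18.6, proof of Thm. 18.6 (reduction modulo 𝔓 passage), pp. 127–128] -/
theorem IsReflexTypeNorm.map_le_map {Φ : Set (K →+* L)} {j : K →+* L} {σ₀ : k →+* L} {𝔞 : Ideal (𝓞 k)}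
    {𝔟 : Ideal (𝓞 K)} (h : IsReflexTypeNorm Φ j σ₀ 𝔞 𝔟) {φ : K →+* L} (hφ : φ ∈ Φ) :
    𝔟.map (RingOfIntegers.mapRingHom φ) ≤ 𝔞.map (RingOfIntegers.mapRingHom σ₀) := by
  have h' : IsReflexTypeNorm Φ φ σ₀ 𝔞 𝔟 := h.of_basePoint φ
  rw [IsReflexTypeNorm] at h'
  rw [h']
  exact reflexNormIdeal_le_map_self σ₀ 𝔞 hφ

/-- Divisibility form of the reflex inclusion: `𝔞^{σ₀}𝔬_L ∣ φ(𝔟)𝔬_L` for `φ ∈ Φ`. [cite: Shimura1998, §13.2, pp. 99–100] -/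
theorem IsReflexTypeNorm.map_dvd_map {Φ : Set (K →+* L)} {j : K →+* L} {σ₀ : k →+* L} {𝔞 : Ideal (𝓞 k)}
    {𝔟 : Ideal (𝓞 K)} (h : IsReflexTypeNorm Φ j σ₀ 𝔞 𝔟) {φ : K →+* L} (hφ : φ ∈ Φ) :
    𝔞.map (RingOfIntegers.mapRingHom σ₀) ∣ 𝔟.map (RingOfIntegers.mapRingHom φ) :=
  Ideal.dvd_iff_le.2 (h.map_le_map hφ)

/-- **Element / prime form of the reflex inclusion**: for an ideal `𝔓 ⊇ 𝔞^{σ₀}𝔬_L` of `𝔬_L` (e.g. a prime of `L`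
above `σ₀(𝔞)`), every `α ∈ 𝔟 = g(𝔞)` has `φ(α) ∈ 𝔓` for every `φ ∈ Φ` («`φ(α) ∈ φ(𝔮) ⊆ 𝔓̃`»).
[cite: Shimura1998, §13.2, pp. 99–100; §18.6, proof of Thm. 18.6 (reduction modulo 𝔓 passage), pp. 127–128] -/
theorem IsReflexTypeNorm.mapRingHom_mem {Φ : Set (K →+* L)} {j : K →+* L} {σ₀ : k →+* L} {𝔞 : Ideal (𝓞 k)}
    {𝔟 : Ideal (𝓞 K)} (h : IsReflexTypeNorm Φ j σ₀ 𝔞 𝔟) {φ : K →+* L} (hφ : φ ∈ Φ) {𝔓 : Ideal (𝓞 L)}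
    (h𝔓 : 𝔞.map (RingOfIntegers.mapRingHom σ₀) ≤ 𝔓) {α : 𝓞 K} (hα : α ∈ 𝔟) :
    RingOfIntegers.mapRingHom φ α ∈ 𝔓 :=
  h𝔓 (h.map_le_map hφ (Ideal.mem_map_of_mem _ hα))

/-- The same with the prime given by its contraction: `𝔞 ⊆ σ₀⁻¹(𝔓)` (e.g. `𝔓 ∩ 𝔬_k = 𝔞` for a prime `𝔓` of `L` over
the prime `𝔞` of `k`). [cite: Shimura1998, §13.2, pp. 99–100] -/
theorem IsReflexTypeNorm.mapRingHom_mem_of_le_comap {Φ : Set (K →+* L)} {j : K →+* L} {σ₀ : k →+* L}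
    {𝔞 : Ideal (𝓞 k)} {𝔟 : Ideal (𝓞 K)} (h : IsReflexTypeNorm Φ j σ₀ 𝔞 𝔟) {φ : K →+* L} (hφ : φ ∈ Φ)
    {𝔓 : Ideal (𝓞 L)} (h𝔓 : 𝔞 ≤ 𝔓.comap (RingOfIntegers.mapRingHom σ₀)) {α : 𝓞 K} (hα : α ∈ 𝔟) :
    RingOfIntegers.mapRingHom φ α ∈ 𝔓 :=
  h.mapRingHom_mem hφ (Ideal.map_le_iff_le_comap.2 h𝔓) hα

/-- Read on `K`: `𝔟 ⊆ φ⁻¹(𝔓)` for every `φ ∈ Φ` and every ideal `𝔓 ⊇ 𝔞^{σ₀}𝔬_L`. [cite: Shimura1998, §13.2, pp. 99–100] -/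
theorem IsReflexTypeNorm.le_comap {Φ : Set (K →+* L)} {j : K →+* L} {σ₀ : k →+* L} {𝔞 : Ideal (𝓞 k)}
    {𝔟 : Ideal (𝓞 K)} (h : IsReflexTypeNorm Φ j σ₀ 𝔞 𝔟) {φ : K →+* L} (hφ : φ ∈ Φ) {𝔓 : Ideal (𝓞 L)}
    (h𝔓 : 𝔞.map (RingOfIntegers.mapRingHom σ₀) ≤ 𝔓) :
    𝔟 ≤ 𝔓.comap (RingOfIntegers.mapRingHom φ) :=
  Ideal.map_le_iff_le_comap.1 ((h.map_le_map hφ).trans h𝔓)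

end Inclusion

/-! ## §3. The CM-type spelling: `Φ = valuedIn ι Φ_ℂ` (the `_h𝔮` clause of `shimuraTaniyamaPair_degOne'`) -/

section ValuedIn

variable {K k L : Type*} [Field K] [CharZero K] [Field k] [NumberField k] [Field L] [NumberField L] [Normal ℚ L]

/-- **Reflex inclusion, CM-type spelling**: for a type `Φ_ℂ ⊆ Hom(K, ℂ)` read in `L` through `ι : L → ℂ`
(`valuedIn ι Φ_ℂ = {φ | ι ∘ φ ∈ Φ_ℂ}`), `IsReflexTypeNorm (valuedIn ι Φ_ℂ) j σ₀ 𝔞 𝔟` gives `φ(𝔟)𝔬_L ⊆ 𝔞^{σ₀}𝔬_L`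
for every `φ : K → L` with `ι ∘ φ ∈ Φ_ℂ` — the shape of the hypothesis `_h𝔮` of `shimuraTaniyamaPair_degOne'`
(`𝔞 := 𝔭`, `𝔟 := 𝔮 = g(𝔭)`). [cite: Shimura1998, §13.2, pp. 99–100; §18.6, proof of Thm. 18.6 (reduction modulo 𝔓 passage), pp. 127–128] -/
theorem IsReflexTypeNorm.map_le_map_of_comp_mem {Φc : Set (K →+* ℂ)} {ι : L →+* ℂ} {j : K →+* L}
    {σ₀ : k →+* L} {𝔞 : Ideal (𝓞 k)} {𝔟 : Ideal (𝓞 K)} (h : IsReflexTypeNorm (valuedIn ι Φc) j σ₀ 𝔞 𝔟)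
    {φ : K →+* L} (hφ : ι.comp φ ∈ Φc) :
    𝔟.map (RingOfIntegers.mapRingHom φ) ≤ 𝔞.map (RingOfIntegers.mapRingHom σ₀) :=
  h.map_le_map (show φ ∈ valuedIn ι Φc from hφ)

/-- Element form of the CM-type spelling: `ι ∘ φ ∈ Φ_ℂ`, `𝔞^{σ₀}𝔬_L ⊆ 𝔓`, `α ∈ 𝔟` ⟹ `φ(α) ∈ 𝔓`.
[cite: Shimura1998, §13.2, pp. 99–100; §18.6, proof of Thm. 18.6 (reduction modulo 𝔓 passage), pp. 127–128] -/
theorem IsReflexTypeNorm.mapRingHom_mem_of_comp_mem {Φc : Set (K →+* ℂ)} {ι : L →+* ℂ} {j : K →+* L}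
    {σ₀ : k →+* L} {𝔞 : Ideal (𝓞 k)} {𝔟 : Ideal (𝓞 K)} (h : IsReflexTypeNorm (valuedIn ι Φc) j σ₀ 𝔞 𝔟)
    {φ : K →+* L} (hφ : ι.comp φ ∈ Φc) {𝔓 : Ideal (𝓞 L)} (h𝔓 : 𝔞.map (RingOfIntegers.mapRingHom σ₀) ≤ 𝔓)
    {α : 𝓞 K} (hα : α ∈ 𝔟) : RingOfIntegers.mapRingHom φ α ∈ 𝔓 :=
  h.mapRingHom_mem (show φ ∈ valuedIn ι Φc from hφ) h𝔓 hα

end ValuedIn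

end Literature.NumberTheory.ComplexMultiplication

end
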